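import Literature.Claims.NS.ClayTorusBridge
import Literature.Analysis.FluidPDE.TorusClassicalNSGalileanBoost
import HarnessLib

/-!
# C130 `Zajaczkowski2018` — W. M. Zajączkowski, «On regular periodic solutions to the Navier–Stokes
# equations», arXiv:1810.04928 v3 (2019-07-22) [Zajaczkowski2018] — typed skeleton (D-0090 NS-CLAIMS SWEEP)

Cell `ns-claims`, claim C130 (census DELTA-20; NUMBERED RULINGS v1.30h (a); tier T2 FULL-lite).
Typist ns-claims-typist-9 g2. Text of record: v3, 28 pp., PDF page = printed page; TeX line numbers are
those of `sources/Zajaczkowski2018/arXiv-1810.04928/v3/src/main.unix.tex` (lit-1 g6 LOCATORS.md).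
Rev 3 (typist-8 g3, CARD holder): print-page slips corrected per REF C130 ref-2 g4 2026-08-27T03:50:36Z —
«We are not able to do it for solutions to (1.1) directly» is TeX l.199 and «we proved in [Z1] …» is TeX l.202, both
on PDF p. 3 (rev 1/2 wrote «p. 5 (l.275)» / «p. 5 (l.201)»); Theorem B p. 5 opens «Let Assumption 1 hold» in print
(= Assumption A p. 4). Declarations unchanged.
Versions/dependency cell (not typed): v1 (2018) labels the main result «Theorem A under Assumptions
1–2» = v3 «Theorem B under Assumption A»; companion arXiv:2009.07631 (2020); printed dependency
[Z1] = arXiv:1810.04926 v3 (weakly compressible barotropic system).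

## What the text asserts (verbatim, v3)

* Abstract p. 1 (l.99–111): «We find a global a priori estimate for solutions to the Navier-Stokes
  equations with periodic boundary conditions guaranteeing in view of the Serrin type condition the
  existence of global regular solutions. We derive the following estimate ‖V(t)‖_{H¹(Ω)} ≤ c, (1) where V
  is the velocity of the fluid. The estimate (1) is proved in two steps. First we derive a global estimate
  guaranteeing the existence of global regular solutions to weakly compressible Navier-Stokes equations
  with large second viscosity, density close to a constant and gradient part of velocity small. Next we
  show that solutions to the Navier-Stokes equations remain close to solutions to the weakly compressible
  Navier-Stokes equations if the corresponding initial data and external forces are sufficiently close.»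
* §1 p. 1 (l.119): «We are going to prove existence of global regular periodic solutions to the
  Navier-Stokes equations in a box Ω ⊂ ℝ³» — system (1.1): `a(V_t + V·∇V) − μΔV + ∇P = aF`, `div V = 0`,
  `V|_{t=0} = V₀`, `a > 0` constant, `μ > 0`.
* §1 p. 2 (l.131): «Since the existence of global regular solutions to weakly compressible … Navier-Stokes
  equations is known (see [Z1]) we are looking for solutions to (1.1) as for stability of these regular
  solutions.»; p. 3 (TeX l.202): «we proved in [Z1] the existence of global regular solutions to weakly
  compressible Navier-Stokes system (1.4) … Therefore solutions to (1.1) are approximated by solutions to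
  (1.4). Hence we have the system with small data so global estimates for regular solutions are easily
  derived.»; p. 3 (TeX l.199): «We are not able to do it for solutions to (1.1) directly.»
* Theorem A p. 4 (l.202–224, the [Z1] input): for `ν` (second viscosity) large and `T < ν` a regular
  solution of the weakly compressible system (1.4) on `[0,T]` with the estimate (1.11) `‖v‖ ≤ D(0)`; then
  «Assuming the decay ‖f(t)‖₁ ≤ f₀e^{−αt} …, and that D(kT) is finite, where interval (0,T) is replaced by
  (kT,(k+1)T), k ∈ ℕ₀ and assuming that T is such that −(a_*/2)T + c∫₀^T(|v(t)|²_{3,1} + |Δφ(t)|²_∞ +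
  ‖v(t)‖₁⁴ + ‖f(t)‖₁²)dt ≤ 0 … we obtain that ‖v‖_{𝔑(Ω×(kT,(k+1)T))} ≤ D(kT).»
* Assumption A p. 4 (l.225–240): an ASSUMED bound `∫_{kT}^{(k+1)T} B₂²(t)dt ≤ c(D²(kT) + D²(kT)/ν² + A₁²A₂²)`,
  `k ∈ ℕ₀`, for the Theorem-A solution.
* Theorem B p. 5 (l.241–265, THE MAIN RESULT): «Let Assumption 1 hold [sic: = Assumption A p. 4, the only
  assumption environment of v3 — v1's «Assumptions 1 and 2» were renamed]. Let (u,η) satisfy problem (1.9),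
  (1.10). Assume that |u_x(0)|₂² ≤ γ ∈ (0, γ_*] … Assume that ‖g_r(t)‖₁² ≤ γ₀² exp(−αt) … Then for
  sufficiently small γ, γ₀ and sufficiently large T we have ‖u(t)‖₁² ≤ γ exp[2c∫_{kT}^{(k+1)T}B₂²(t)dt],
  k ∈ ℕ₀, t ∈ [kT,(k+1)T]. Then for solutions to problem (1.1) we have ‖V(t)‖₁² ≤ γ exp[2c∫_{kT}^t B₂²]
  + D²(kT)», where `u = v − V`, `g = f − F` ((1.5) p. 2): the NS data `(V₀, F)` are `γ`-close to the data
  `(v₀, f)` of the auxiliary Theorem-A flow.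
* Remark C p. 5 (l.266–268), complete: «We hope that the paper meets one of the statements from [F].»
  ([F] = Fefferman's CMI text; no other Clay/Millennium sentence in v3.)

## How it is typed (FULL-lite grain: the STATEMENT and the composition; the weakly compressible machinery
## of [Z1] is an ATTACHMENT, nothing of it asserted)

Vocabulary = the tree's flat torus `𝕋³ = UnitAddTorus (Fin 3)` («periodic boundary conditions … in a box»,
by `ClayVariants.clayPeriodic_regularityAt_iff_torus` this is Fefferman's (B) vocabulary, no Δ1 delta),
classical solutions `Torus.IsClassicalNSSolutionOn`, enstrophy `Torus.gradNormSq u = ∫_{𝕋³}‖∇u‖²`.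
The Clay reading fixes `a = 1`, `F ≡ 0` (the paper allows a constant `a > 0` and a force — (B) is the
special case, so no wrong-problem axis arises from them).

* `ClaimedTheorem` — the abstract's estimate (1) read, as the abstract and the opening sentence of §1 read
  it, for EVERY smooth divergence-free periodic datum and every viscosity: along every classical solution
  of the unforced system on any `[0,T)` issued from `V₀`, `‖∇V(t)‖²_{L²(𝕋³)} ≤ c(V₀)` (the `H¹`-norm of (1)
  dominates the enstrophy, so this is (1) or weaker). `clay_of_claimed : ClaimedTheorem → (B)` is PROVED —
  this is the abstract's «in view of the Serrin type condition» clause, certified in the kernel by the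
  tree's maximal-solution / enstrophy blow-up alternative on `𝕋³`
  (`Torus.exists_maximal_classicalNS_anyMean`, Robinson–Rodrigo–Sadowski 2016 §6.3/§8.1).
* `AuxScheme` — ATTACHMENT for the two-step architecture: `adm ν V₀` = «the datum `V₀` (with `F ≡ 0`)
  admits a global regular weakly-compressible companion flow as described by Theorem A on every window
  `[kT,(k+1)T]` (`D(kT)` finite, the `T`-condition) and satisfying Assumption A» — the standing input of
  Theorem B; `bound ν V₀` = the constant the scheme outputs (`sup_k (γe^{2c∫B₂²} + D²(kT))`).
* `Step1_AuxGlobal att` — §1 p. 2 l.131 / p. 3 (TeX l.202) with Theorem A p. 4 and Assumption A p. 4: EVERY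
  smooth divergence-free periodic datum is admissible («the existence of global regular solutions to
  weakly compressible Navier-Stokes equations is known (see [Z1])»). As printed, Theorem A's global part
  is CONDITIONAL («assuming that D(kT) is finite … and assuming that T is such that …») and Assumption A
  is an assumption: this is the coverage step the abstract's unconditional (1) needs.
* `Step2_TheoremB att` — Theorem B p. 5 specialised to identical data (`v₀ = V₀`, `f = F = 0`, so
  `u(0) = 0`, `g = 0` and the smallness hypotheses `|u_x(0)|₂² ≤ γ`, `‖g_r‖ ≤ γ₀e^{−αt}` hold for every
  `γ, γ₀ > 0`): an admissible datum has the a priori enstrophy bound along all its classical NS solutions.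
  (Weaker than the printed perturbation statement; it is the instance the Clay reading consumes.)
* `claim_of_steps att : Step1_AuxGlobal att → Step2_TheoremB att → ClaimedTheorem` and
  `clay_of_steps` — PROVED (the paper composes: abstract «The estimate (1) is proved in two steps»).
* No kernel kill kit is offered: at this grain `Step1_AuxGlobal att` takes its truth value from the
  untyped attachment (C90/C109/C123 precedent); the typed record is the composition + the PROVED Serrin
  bridge. Candidate locator for the refuter/referee: `Step1_AuxGlobal` (unfilled gap: conditional global
  existence for the auxiliary compressible system presented as «known»; Remark C «We hope …»; §1 p. 3 TeX l.199
  «We are not able to do it for solutions to (1.1) directly»), with Theorem B's own step-by-step-in-time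
  induction (Remark 3.3 p. 20 l.856 «we assume that in each time interval [kT,(k+1)T] the first part of
  Theorem B holds which is proved step by step in time»; Lemma 3.4 p. 23, closing sentence p. 25) as the
  proof-grain fallback.

WHAT THIS IS NOT: not a claim about NS regularity or blow-up; not a claim about any author beyond the
typed locator.
-/

noncomputable section

open Set MeasureTheory
open scoped ContDiff

namespace Literature.Claims.NS.Zajaczkowski2018

open Literature.Analysis Literature.Analysis.FluidPDE Literature.Analysis.FunctionSpaces
open Literature.Claims.NS.ClayVariants

/-- `ℝ³` (values of the velocity field). [cite: Zajaczkowski2018, §1 (1.1) p. 1] -/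
abbrev E3 : Type := EuclideanSpace ℝ (Fin 3)

/-- The periodic box `Ω` read as the flat torus `𝕋³ = ℝ³/ℤ³`. [cite: Zajaczkowski2018, §1 p. 1 («periodic
solutions … in a box Ω ⊂ ℝ³»)] -/
abbrev T3 : Type := UnitAddTorus (Fin 3)

/-! ## §A. The claimed estimate (1) and its Clay link -/

/-- **The a priori estimate (1) at the strength the abstract states it** (abstract p. 1, l.99–105: «We find
a global a priori estimate for solutions to the Navier-Stokes equations with periodic boundary conditions
… We derive the following estimate ‖V(t)‖_{H¹(Ω)} ≤ c, (1)»; §1 l.119 «We are going to prove existence of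
global regular periodic solutions»), for one viscosity `ν`, with `a = 1`, `F ≡ 0`: for every smooth
divergence-free datum `V₀` on `𝕋³` there is `c` such that every classical solution of the unforced
system on any `[0,T)` with `V(0) = V₀` has `‖∇V(t)‖²_{L²} ≤ c` for all `t ∈ [0,T)` (enstrophy ≤ the
squared `H¹` norm of (1)). [cite: Zajaczkowski2018, abstract (1) p. 1; §1 p. 1 l.119] -/
def AprioriBound (ν : ℝ) : Prop :=
  ∀ V₀ : T3 → E3, Torus.IsSmooth V₀ → Torus.IsDivFree V₀ →
    ∃ c : ℝ, ∀ T : ℝ, 0 < T →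
      ∀ (V : ℝ → T3 → E3) (P : ℝ → T3 → ℝ),
        Torus.IsClassicalNSSolutionOn (Ico 0 T) ν 0 V P → V 0 = V₀ →
          ∀ t ∈ Ico 0 T, Torus.gradNormSq (V t) ≤ c

/-- **The claimed theorem** (census/abstract reading): estimate (1) for every viscosity `μ > 0`
(the paper's `μ > 0` is arbitrary, (1.1) p. 1). [cite: Zajaczkowski2018, abstract (1) p. 1; (1.1) p. 1] -/
def ClaimedTheorem : Prop :=
  ∀ ν : ℝ, 0 < ν → AprioriBound ν

/-- **The Serrin-type bridge is TRUE, in the kernel**: the a priori enstrophy bound at viscosity `ν > 0`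
gives Clay (B) at `ν` — every smooth divergence-free datum on `𝕋³` has a global classical solution —
by the tree's maximal solution with the enstrophy blow-up alternative (Robinson–Rodrigo–Sadowski 2016
§6.3 p.108 / §8.1 p.122, any mean) and the torus form of (B). This certifies the abstract's clause
«guaranteeing in view of the Serrin type condition the existence of global regular solutions».
[cite: Zajaczkowski2018, abstract p. 1] [cite: RobinsonRodrigoSadowskiCUP2016, §6.3 p. 108, §8.1 p. 122]
[cite: FeffermanClay2006, (B) p. 2] -/
theorem clayAt_of_aprioriBound {ν : ℝ} (hν : 0 < ν) (h : AprioriBound ν) :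
    clayPeriodic.RegularityAt ν := by
  rw [clayPeriodic_regularityAt_iff_torus hν]
  intro U₀ hs hd
  obtain ⟨c, hc⟩ := h U₀ hs hd
  obtain ⟨u, p, hu0, hcases⟩ :=
    Torus.exists_maximal_classicalNS_anyMean (d := Fin 3) (by simp) hν hs hd
  rcases hcases with ⟨hglob, -⟩ | ⟨T, hT, hsol, hnb, -⟩
  · exact ⟨u, p, hglob, hu0⟩
  · refine absurd ⟨c, ?_⟩ hnb
    rintro _ ⟨t, ht, rfl⟩
    exact hc T hT u p hsol hu0 t ht

/-- **`ClaimedTheorem → (B)`** (`ClayVariants.clayPeriodic.Regularity`; Clay delta: none — `a = 1`,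
`F ≡ 0` are the special case of the printed setting, the box is `𝕋³`, the conclusion is stronger than
(B)). [cite: Zajaczkowski2018, abstract p. 1; Remark C p. 5] [cite: FeffermanClay2006, (B) p. 2] -/
theorem clay_of_claimed (h : ClaimedTheorem) : clayPeriodic.Regularity :=
  fun ν hν => clayAt_of_aprioriBound hν (h ν hν)

/-! ## §B. The two-step architecture (ATTACHMENT; nothing asserted) -/

/-- ATTACHMENT for the weakly-compressible scheme of [Z1]/Theorem A/Assumption A (the objects `(v, η)`,
`φ, ψ`, `D(kT)`, `B₂`, `A₁, A₂`, `ν`, `T` are not typed at FULL-lite grain): `adm ν V₀` = the datum `V₀`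
(force `F ≡ 0`) admits a global regular weakly-compressible companion flow «described by Theorem A» on
every window `[kT,(k+1)T]` and satisfying Assumption A; `bound ν V₀` = the constant the scheme then
delivers for `‖V(t)‖₁²` (`γ e^{2c∫B₂²} + D²(kT)`, uniformly in `k`).
[cite: Zajaczkowski2018, Theorem A p. 4; Assumption A p. 4; Theorem B p. 5] -/
structure AuxScheme where
  /-- admissibility of a datum for the scheme at viscosity `ν` -/
  adm : ℝ → (T3 → E3) → Prop
  /-- the a priori constant delivered for an admissible datum -/
  bound : ℝ → (T3 → E3) → ℝ

/-- **Step 1 — the auxiliary global flow exists for every datum** (§1 p. 2 l.131 «Since the existence of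
global regular solutions to weakly compressible … Navier-Stokes equations is known (see [Z1])»; p. 3 (TeX l.202)
«we proved in [Z1] the existence of global regular solutions to weakly compressible Navier-Stokes system
(1.4)»; Theorem A p. 4 — whose global part is printed CONDITIONALLY: «assuming that D(kT) is finite …
and assuming that T is such that −(a_*/2)T + c∫₀^T(|v(t)|²_{3,1} + |Δφ(t)|²_∞ + ‖v(t)‖₁⁴ + ‖f(t)‖₁²)dt
≤ 0»; Assumption A p. 4 is an assumption): every smooth divergence-free periodic datum is admissible.
[cite: Zajaczkowski2018, §1 p. 2 l.131; p. 3 (TeX l.202); Theorem A p. 4; Assumption A p. 4] -/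
def Step1_AuxGlobal (att : AuxScheme) : Prop :=
  ∀ ν : ℝ, 0 < ν → ∀ V₀ : T3 → E3, Torus.IsSmooth V₀ → Torus.IsDivFree V₀ → att.adm ν V₀

/-- **Step 2 — Theorem B p. 5** (l.241–265), specialised to identical data `v₀ = V₀`, `f = F ≡ 0`
(so `u(0) = 0`, `g = 0`: the hypotheses `|u_x(0)|₂² ≤ γ`, `‖g_r(t)‖₁² ≤ γ₀²e^{−αt}` hold for every
`γ, γ₀ > 0`): an admissible datum carries the a priori bound «‖V(t)‖₁² ≤ γ exp[2c∫B₂²] + D²(kT), t ∈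
[kT,(k+1)T]» along every classical NS solution issued from it, typed on the enstrophy with the scheme's
constant. [cite: Zajaczkowski2018, Theorem B p. 5; (1.5) p. 2] -/
def Step2_TheoremB (att : AuxScheme) : Prop :=
  ∀ ν : ℝ, 0 < ν → ∀ V₀ : T3 → E3, Torus.IsSmooth V₀ → Torus.IsDivFree V₀ → att.adm ν V₀ →
    ∀ T : ℝ, 0 < T →
      ∀ (V : ℝ → T3 → E3) (P : ℝ → T3 → ℝ),
        Torus.IsClassicalNSSolutionOn (Ico 0 T) ν 0 V P → V 0 = V₀ →
          ∀ t ∈ Ico 0 T, Torus.gradNormSq (V t) ≤ att.bound ν V₀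

/-- **Composition** («The estimate (1) is proved in two steps», abstract p. 1): PROVED — the paper
composes; the weight is on Step 1. [cite: Zajaczkowski2018, abstract p. 1] -/
theorem claim_of_steps (att : AuxScheme) (h1 : Step1_AuxGlobal att) (h2 : Step2_TheoremB att) :
    ClaimedTheorem := by
  intro ν hν V₀ hs hd
  exact ⟨att.bound ν V₀, fun T hT V P hV h0 t ht => h2 ν hν V₀ hs hd (h1 ν hν V₀ hs hd) T hT V P hV h0 t ht⟩

/-- **Steps ⇒ Clay (B)**. [cite: Zajaczkowski2018, abstract p. 1; Remark C p. 5 («We hope that the paper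
meets one of the statements from [F].»)] [cite: FeffermanClay2006, (B) p. 2] -/
theorem clay_of_steps (att : AuxScheme) (h1 : Step1_AuxGlobal att) (h2 : Step2_TheoremB att) :
    clayPeriodic.Regularity :=
  clay_of_claimed (claim_of_steps att h1 h2)

/-- Non-vacuity of the attachment slot: the scheme that admits every datum (Step 1 then holds
tautologically and Step 2 IS the claimed estimate — the honest reading «(1) for all data is exactly what
remains to be proved»). [cite: Zajaczkowski2018, §1 p. 3 (TeX l.199) («We are not able to do it for solutions to
(1.1) directly.»)] -/
def AuxScheme.trivial (c : ℝ → (T3 → E3) → ℝ) : AuxScheme := ⟨fun _ _ => True, c⟩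

/-- For the all-admitting scheme Step 1 holds. [cite: Zajaczkowski2018, §1 p. 2 l.131] -/
theorem step1_trivial (c : ℝ → (T3 → E3) → ℝ) : Step1_AuxGlobal (AuxScheme.trivial c) :=
  fun _ _ _ _ _ => trivial

/-! ## §C. Kernel record at the all-admitting scheme (rev 2, additive; typist-8 g3 second-reader kit, ROUTE 5b)

At FULL-lite grain the conditional provisos of Theorem A p. 4 («D(kT) is finite», the `T`-condition) and
Assumption A p. 4 live in the opaque admissibility predicate `adm`. The following two kernel facts record
what the skeleton's Steps say when NO admissibility restriction is imposed (`AuxScheme.trivial`: Step 1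
is then a tautology, `step1_trivial`): Step 2 with the delivered constants `c` is LITERALLY the a priori
bound (1) with those constants, and «some constant map makes Step 2 hold» is EQUIVALENT to the claimed
theorem. Nothing is asserted about the paper's scheme; these are `Iff`s about the typed Props. -/

/-- **Step 2 at the all-admitting scheme, unfolded**: for the scheme admitting every datum and delivering
the constants `c ν V₀`, `Step2_TheoremB` is the statement «every classical solution from every smooth
divergence-free periodic datum has enstrophy ≤ `c ν V₀`» — estimate (1) with prescribed constants.
[cite: Zajaczkowski2018, Theorem B p. 5; abstract (1) p. 1] -/
theorem step2_trivial_iff (c : ℝ → (T3 → E3) → ℝ) :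
    Step2_TheoremB (AuxScheme.trivial c) ↔
      ∀ ν : ℝ, 0 < ν → ∀ V₀ : T3 → E3, Torus.IsSmooth V₀ → Torus.IsDivFree V₀ →
        ∀ T : ℝ, 0 < T →
          ∀ (V : ℝ → T3 → E3) (P : ℝ → T3 → ℝ),
            Torus.IsClassicalNSSolutionOn (Ico 0 T) ν 0 V P → V 0 = V₀ →
              ∀ t ∈ Ico 0 T, Torus.gradNormSq (V t) ≤ c ν V₀ := by
  refine ⟨fun h ν hν V₀ hs hd T hT V P hV h0 t ht => ?_, fun h ν hν V₀ hs hd _ T hT V P hV h0 t ht => ?_⟩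
  · exact h ν hν V₀ hs hd trivial T hT V P hV h0 t ht
  · exact h ν hν V₀ hs hd T hT V P hV h0 t ht

/-- **ROUTE-5b record: at the all-admitting scheme, «Step 2 holds for some constants» IS the claimed
theorem.** (`→`: compose with the tautological Step 1, `claim_of_steps`; `←`: take for `c ν V₀` the
constant the claimed theorem provides, by choice.) So whatever content Theorem B adds beyond (1) itself
sits in the admissibility predicate — Theorem A's provisos and Assumption A p. 4 — i.e. in Step 1.
[cite: Zajaczkowski2018, Theorem B p. 5; Theorem A p. 4; Assumption A p. 4; §1 p. 3 (TeX l.199)] -/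
theorem step2_trivial_iff_claimedTheorem :
    (∃ c : ℝ → (T3 → E3) → ℝ, Step2_TheoremB (AuxScheme.trivial c)) ↔ ClaimedTheorem := by
  classical
  constructor
  · rintro ⟨c, h⟩
    exact claim_of_steps (AuxScheme.trivial c) (step1_trivial c) h
  · intro h
    refine ⟨fun ν V₀ =>
      if hν : 0 < ν then
        if hs : Torus.IsSmooth V₀ ∧ Torus.IsDivFree V₀ then Classical.choose (h ν hν V₀ hs.1 hs.2) else 0
      else 0, ?_⟩
    rw [step2_trivial_iff]
    intro ν hν V₀ hs hd T hT V P hV h0 t ht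
    rw [dif_pos hν, dif_pos ⟨hs, hd⟩]
    exact Classical.choose_spec (h ν hν V₀ hs hd) T hT V P hV h0 t ht

end Literature.Claims.NS.Zajaczkowski2018

end
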